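import Mathlib.Analysis.Calculus.Deriv.Shift
import Literature.AlgebraicGeometry.RealAlgebraic.RealAbelJacobi
import Literature.NumberTheory.Transcendental.KZRelationsLE
import Literature.NumberTheory.Transcendental.KZLogCalculusProofs
import HarnessLib

/-!
# Route AbelContraction — helpers toward `AbelContractionLemma` (item stmt-KontsevichZagierPeriods-12873)

**Abel's theorem is rule 1(b) inside dimension one.** Step (i) of the contraction mechanism of
card `abel-contraction-real-jacobian-v2` (K1, `AbelContractionLemma`): along a real component of
the difference correspondence, Abel's theorem in differential form
(`RealAbelJacobi.invForm_ajSum`: `ωᵢ(Σₗ aj γₗ(t))(w) = Σₗ αᵢ(γₗ t)(γₗ′ t)`, with `w` the velocity of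
the moving sum) turns "the Abel sum is constant" (`w = 0`) into the POINTWISE vanishing of the sum
of the `ℚ`-semialgebraic integrands `t ↦ αᵢ(γₗ t)(γₗ′ t)`; and one-dimensional representations
over a common domain whose integrands sum to zero pointwise sum to an element of the truncated
relations `KZ.relationsLE 1` by iterated integrand additivity (rule 1(b)) — no change of
variables, no Newton–Leibniz, no representation of dimension `≥ 2`.

Contents:
* `mem_relationsLE_of_integrandAdd`, `of_mem_relationsLE_of_eqOn_zero`,
  `of_sub_sum_mem_relationsLE`, `sum_of_mem_relationsLE_of_sum_eqOn_zero` — integrand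
  bookkeeping INSIDE dimension `≤ d` (the `relations`-versions exist in
  `KZGroundingRelations` / `KZLogCalculusProofs`; the truncated calculus needs the dimension
  certificate);
* `sum_curveForm_deriv_eq_zero` — Abel pointwise at a parameter `t`: if the moving sum
  `s ↦ aj γ₀(s) + ⋯ + aj γₙ₋₁(s)` has derivative `0` at `t` then `Σₗ αᵢ(γₗ t)(γₗ′ t) = 0`;
* `sum_of_mem_relationsLE_one_of_hasDerivAt_ajSum` and the locally-constant form
  `sum_of_mem_relationsLE_one_of_ajSum_eventuallyEq` — for one-dimensional representations
  `r l` over a common domain `D ⊆ {p | p 0 ∈ I}` with integrands `p ↦ αᵢ(γₗ (p 0))(γₗ′ (p 0))`,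
  `Σₗ [r l] ∈ KZ.relationsLE 1`.

References: J.-P. Serre, *Algebraic Groups and Class Fields* (1988), Ch. III no. 11 Prop. 17,
Ch. V no. 10 Cor. 1 (additivity of invariant forms, `φ^*ω` of the first kind — packaged in
`Literature.AlgebraicGeometry.RealAlgebraic.RealAbelJacobi`); M. Kontsevich, D. Zagier,
*Periods* (2001), §1.2 rule (1); the truncation `KZ.relationsLE` of
`Literature/NumberTheory/Transcendental/KZRelationsLE.lean`.
-/

noncomputable section

open Set Filter MeasureTheory
open scoped Topology
open Literature.ModelTheory.ExponentialFields
open Literature.NumberTheory.Transcendental Literature.NumberTheory.Transcendental.KZ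
open Literature.AlgebraicGeometry.RealAlgebraic

namespace Summit.KontsevichZagierPeriods.AbelContraction.AbelContractionLemma

/-! ## Integrand bookkeeping inside dimension `≤ d` -/

section Bookkeeping

variable {k d : ℕ}

/-- An integrand-additivity instance (rule 1(b)) among representations of dimension `k ≤ d` is a
truncated relation: `[r] − [r₁] − [r₂] ∈ relationsLE d`. [cite: KontsevichZagier2001, §1.2 rule (1)] -/
theorem mem_relationsLE_of_integrandAdd (hk : k ≤ d) {r r₁ r₂ : IntegralRep k}
    (h₁ : r₁.domain = r.domain) (h₂ : r₂.domain = r.domain)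
    (h : EqOn r.integrand (r₁.integrand + r₂.integrand) r.domain) :
    of r - of r₁ - of r₂ ∈ relationsLE d := by
  refine movesLE_subset_relationsLE d ⟨Or.inl (Or.inl (Or.inr ⟨k, r, r₁, r₂, h₁, h₂, h, rfl⟩)), ?_⟩
  exact sub_mem (sub_mem (of_mem_formalRepLE r hk) (of_mem_formalRepLE r₁ hk))
    (of_mem_formalRepLE r₂ hk)

/-- A representation of dimension `k ≤ d` whose integrand vanishes on its domain is a truncated
relation (`[r] = [r] + [r]` by rule 1(b)). [cite: KontsevichZagier2001, §1.2 rule (1)] -/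
theorem of_mem_relationsLE_of_eqOn_zero (hk : k ≤ d) (r : IntegralRep k)
    (h : EqOn r.integrand 0 r.domain) : of r ∈ relationsLE d := by
  have h1 : of r - of r - of r ∈ relationsLE d :=
    mem_relationsLE_of_integrandAdd hk rfl rfl fun x hx => by
      have hx0 : r.integrand x = 0 := h hx
      simp [hx0]
  have e : of r - of r - of r = -of r := by abel
  rw [e] at h1
  simpa using (relationsLE d).neg_mem h1

/-- **Iterated integrand additivity inside dimension `≤ d`**: if the `R i` (`i ∈ s`) have the
domain of `r` (dimension `k ≤ d`) and `r.integrand = Σᵢ (R i).integrand` on it, then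
`[r] − Σᵢ [R i] ∈ relationsLE d`. [cite: KontsevichZagier2001, §1.2 rule (1)] -/
theorem of_sub_sum_mem_relationsLE (hk : k ≤ d) {ι : Type*} (s : Finset ι) (R : ι → IntegralRep k) :
    ∀ r : IntegralRep k, (∀ i ∈ s, (R i).domain = r.domain) →
      EqOn r.integrand (fun x => ∑ i ∈ s, (R i).integrand x) r.domain →
      of r - ∑ i ∈ s, of (R i) ∈ relationsLE d := by
  classical
  induction s using Finset.induction_on with
  | empty =>
    intro r _ h
    simp only [Finset.sum_empty, sub_zero]
    exact of_mem_relationsLE_of_eqOn_zero hk r fun x hx => by simpa using h hx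
  | insert a s ha ih =>
    intro r hd h
    -- the partial representation `[σ, Σ_{i ∈ s} (R i).integrand]`
    let r' : IntegralRep k :=
      { domain := r.domain
        integrand := fun x => ∑ i ∈ s, (R i).integrand x
        isSemialgebraic_domain := r.isSemialgebraic_domain
        isSemialgebraicFunOn_integrand :=
          isSemialgebraicFunOn_finset_sum s r.isSemialgebraic_domain fun i hi =>
            hd i (Finset.mem_insert_of_mem hi) ▸ (R i).isSemialgebraicFunOn_integrand
        integrableOn := integrable_finsetSum s fun i hi =>
          hd i (Finset.mem_insert_of_mem hi) ▸ (R i).integrableOn }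
    have e1 : of r - of (R a) - of r' ∈ relationsLE d :=
      mem_relationsLE_of_integrandAdd hk (hd a (Finset.mem_insert_self a s)) rfl fun x hx => by
        show r.integrand x = (R a).integrand x + ∑ i ∈ s, (R i).integrand x
        rw [h hx]
        exact Finset.sum_insert ha
    have e2 : of r' - ∑ i ∈ s, of (R i) ∈ relationsLE d :=
      ih r' (fun i hi => hd i (Finset.mem_insert_of_mem hi)) fun x _ => rfl
    rw [Finset.sum_insert ha]
    have e : of r - (of (R a) + ∑ i ∈ s, of (R i)) =
        (of r - of (R a) - of r') + (of r' - ∑ i ∈ s, of (R i)) := by abel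
    rw [e]
    exact (relationsLE d).add_mem e1 e2

/-- **Representations over a common domain whose integrands sum to zero pointwise sum to a
truncated relation**: if the `R i` (`i ∈ s`, dimension `k ≤ d`) all have domain `σ` and
`Σᵢ (R i).integrand = 0` on `σ`, then `Σᵢ [R i] ∈ relationsLE d` (rule 1(b) only).
[cite: KontsevichZagier2001, §1.2 rule (1)] -/
theorem sum_of_mem_relationsLE_of_sum_eqOn_zero (hk : k ≤ d) {ι : Type*} (s : Finset ι)
    (R : ι → IntegralRep k) (σ : Set (Fin k → ℝ)) (hd : ∀ i ∈ s, (R i).domain = σ)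
    (h0 : ∀ x ∈ σ, ∑ i ∈ s, (R i).integrand x = 0) :
    ∑ i ∈ s, of (R i) ∈ relationsLE d := by
  classical
  rcases s.eq_empty_or_nonempty with rfl | ⟨i₀, hi₀⟩
  · simp
  · have hσ : IsSemialgebraic ℚ σ := hd i₀ hi₀ ▸ (R i₀).isSemialgebraic_domain
    -- the sum representation `[σ, Σᵢ (R i).integrand]`, whose integrand vanishes on `σ`
    let r : IntegralRep k :=
      { domain := σ
        integrand := fun x => ∑ i ∈ s, (R i).integrand x
        isSemialgebraic_domain := hσ
        isSemialgebraicFunOn_integrand :=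
          isSemialgebraicFunOn_finset_sum s hσ fun i hi => hd i hi ▸ (R i).isSemialgebraicFunOn_integrand
        integrableOn := integrable_finsetSum s fun i hi => hd i hi ▸ (R i).integrableOn }
    have h1 : of r - ∑ i ∈ s, of (R i) ∈ relationsLE d :=
      of_sub_sum_mem_relationsLE hk s R r (fun i hi => hd i hi) fun x _ => rfl
    have h2 : of r ∈ relationsLE d := of_mem_relationsLE_of_eqOn_zero hk r fun x hx => h0 x hx
    have h3 := (relationsLE d).sub_mem h2 h1
    simpa using h3

end Bookkeeping

/-! ## Abel's theorem pointwise ⇒ an integrand-additivity relation in dimension one -/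

section Abel

variable {M N g : ℕ} (A : RealAbelJacobi M N g)

/-- **Abel's theorem pointwise at a parameter `t`.** For curves `γ₀, …, γₙ₋₁` lying in `C(ℝ)`
near `t` and differentiable at `t`, if the moving sum `s ↦ aj γ₀(s) + ⋯ + aj γₙ₋₁(s)` in `J(ℝ)`
has derivative `0` at `t` (e.g. it is constant: the `γₗ(s)` move in a linear system), then for
every form of the first kind `αᵢ` of the package, `Σₗ αᵢ(γₗ t)(γₗ′ t) = 0`
(`RealAbelJacobi.invForm_ajSum` recentred at `t`, and `ωᵢ(x)(0) = 0`). [cite: Serre1988, Ch. III no. 11 Prop. 17 and Ch. V no. 10 Cor. 1] -/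
theorem sum_curveForm_deriv_eq_zero (i : Fin g) {n : ℕ} {γ : Fin n → ℝ → (Fin M → ℝ)} {t : ℝ}
    (hC : ∀ l, ∀ᶠ s in 𝓝 t, γ l s ∈ A.C) (hγ : ∀ l, DifferentiableAt ℝ (γ l) t)
    (hsum : HasDerivAt (fun s => A.ajSum n (fun l => γ l s)) 0 t) :
    ∑ l, A.curveForm i (γ l t) (deriv (γ l) t) = 0 := by
  -- recentre the curves at `0`
  have ht : Tendsto (fun s : ℝ => t + s) (𝓝 0) (𝓝 t) :=
    (continuous_const_add t).tendsto' 0 t (add_zero t)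
  have hC0 : ∀ l, ∀ᶠ s in 𝓝 (0 : ℝ), γ l (t + s) ∈ A.C := fun l => ht.eventually (hC l)
  have hv0 : ∀ l, HasDerivAt (fun s => γ l (t + s)) (deriv (γ l) t) 0 := fun l =>
    HasDerivAt.comp_const_add t 0 (by simpa using (hγ l).hasDerivAt)
  have hw0 : HasDerivAt (fun s => A.ajSum n (fun l => γ l (t + s))) 0 0 :=
    HasDerivAt.comp_const_add (f := fun s => A.ajSum n (fun l => γ l s)) t 0 (by simpa using hsum)
  have key := A.invForm_ajSum i n hC0 hv0 hw0
  simp only [add_zero, map_zero] at key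
  exact key.symm

/-- If the moving sum is locally constant at `t`, it has derivative `0` there. [folklore] -/
theorem hasDerivAt_ajSum_zero_of_eventuallyEq {n : ℕ} {γ : Fin n → ℝ → (Fin M → ℝ)} {t : ℝ}
    (h : ∀ᶠ s in 𝓝 t, A.ajSum n (fun l => γ l s) = A.ajSum n (fun l => γ l t)) :
    HasDerivAt (fun s => A.ajSum n (fun l => γ l s)) 0 t :=
  HasDerivAt.congr_of_eventuallyEq (hasDerivAt_const t (A.ajSum n (fun l => γ l t))) h

/-- **Abel's theorem is an integrand-additivity relation inside dimension one.** Let `γ₀, …, γₙ₋₁`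
be curves which, at every parameter `t ∈ I`, lie in `C(ℝ)` near `t`, are differentiable at `t`,
and whose moving Abel sum `s ↦ aj γ₀(s) + ⋯ + aj γₙ₋₁(s)` has derivative `0` at `t`. If `r l`
(`l < n`) are one-dimensional representations over a common domain `D ⊆ {p | p 0 ∈ I}` with
integrands `p ↦ αᵢ(γₗ (p 0))(γₗ′ (p 0))` on `D`, then `Σₗ [r l] ∈ KZ.relationsLE 1`: the integrands
sum to `0` pointwise by `sum_curveForm_deriv_eq_zero`, and rule 1(b) does the rest
(`sum_of_mem_relationsLE_of_sum_eqOn_zero`). Step (i) of card K1 (`AbelContractionLemma`).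
[cite: Serre1988, Ch. III no. 11 Prop. 17 and Ch. V no. 10 Cor. 1] [cite: KontsevichZagier2001, §1.2 rule (1)] -/
theorem sum_of_mem_relationsLE_one_of_hasDerivAt_ajSum (i : Fin g) {n : ℕ}
    (γ : Fin n → ℝ → (Fin M → ℝ)) (I : Set ℝ)
    (hC : ∀ l, ∀ t ∈ I, ∀ᶠ s in 𝓝 t, γ l s ∈ A.C) (hγ : ∀ l, ∀ t ∈ I, DifferentiableAt ℝ (γ l) t)
    (hsum : ∀ t ∈ I, HasDerivAt (fun s => A.ajSum n (fun l => γ l s)) 0 t)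
    (r : Fin n → IntegralRep 1) (D : Set (Fin 1 → ℝ)) (hD : D ⊆ {p | p 0 ∈ I})
    (hdom : ∀ l, (r l).domain = D)
    (hint : ∀ l, EqOn (r l).integrand (fun p => A.curveForm i (γ l (p 0)) (deriv (γ l) (p 0))) D) :
    ∑ l, of (r l) ∈ relationsLE 1 := by
  refine sum_of_mem_relationsLE_of_sum_eqOn_zero le_rfl Finset.univ r D (fun l _ => hdom l)
    fun p hp => ?_
  have ht : p 0 ∈ I := hD hp
  calc ∑ l, (r l).integrand p
      = ∑ l, A.curveForm i (γ l (p 0)) (deriv (γ l) (p 0)) :=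
        Finset.sum_congr rfl fun l _ => hint l hp
    _ = 0 := sum_curveForm_deriv_eq_zero A i (fun l => hC l _ ht) (fun l => hγ l _ ht) (hsum _ ht)

/-- The same with the hypothesis in the form "the moving Abel sum is locally constant on `I`"
(the points `γₗ(s)` form, up to the fixed part, the divisor of a moving function: Abel).
[cite: Serre1988, Ch. III no. 11 Prop. 17 and Ch. V no. 10 Cor. 1] [cite: KontsevichZagier2001, §1.2 rule (1)] -/
theorem sum_of_mem_relationsLE_one_of_ajSum_eventuallyEq (i : Fin g) {n : ℕ}
    (γ : Fin n → ℝ → (Fin M → ℝ)) (I : Set ℝ)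
    (hC : ∀ l, ∀ t ∈ I, ∀ᶠ s in 𝓝 t, γ l s ∈ A.C) (hγ : ∀ l, ∀ t ∈ I, DifferentiableAt ℝ (γ l) t)
    (hconst : ∀ t ∈ I, ∀ᶠ s in 𝓝 t, A.ajSum n (fun l => γ l s) = A.ajSum n (fun l => γ l t))
    (r : Fin n → IntegralRep 1) (D : Set (Fin 1 → ℝ)) (hD : D ⊆ {p | p 0 ∈ I})
    (hdom : ∀ l, (r l).domain = D)
    (hint : ∀ l, EqOn (r l).integrand (fun p => A.curveForm i (γ l (p 0)) (deriv (γ l) (p 0))) D) :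
    ∑ l, of (r l) ∈ relationsLE 1 :=
  sum_of_mem_relationsLE_one_of_hasDerivAt_ajSum A i γ I hC hγ
    (fun t ht => hasDerivAt_ajSum_zero_of_eventuallyEq A (hconst t ht)) r D hD hdom hint

end Abel

end Summit.KontsevichZagierPeriods.AbelContraction.AbelContractionLemma

end
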